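import Summits.ValiantsHypothesis.ValiantsHypothesis.Theorems.SymmetroidDescartesQuasiRolleToDescartes
import Summits.ValiantsHypothesis.ValiantsHypothesis.Theorems.SymmetroidDescartesDerivedPencilRolleRefutation

/-!
# `DerivedPencilRolleQuasi` — negative lemma: no budget polynomial in the size, whatever its growth in the number of terms

Crux `stmt-ValiantsHypothesis-18064` (`Theses.SymmetroidDescartes.DerivedPencilRolleQuasi`, route
SymmetroidDescartes): `∃ C A, ∀ m K S d (symmetric, invertible, d strictly increasing),
Z₊(det F) ≤ C · Z₊(det ∂F) + (K+1)^(A·K) · 2^((log₂ m + 2)^A)`.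

Refuter (cdisprove) finding, 2026-08-17 — the SHAPE of the budget, size direction.  For every function
`g : ℕ → ℕ` of the number of terms, every multiplier `C` and every degree `A`, the step
`Z₊(det F) ≤ C · Z₊(det ∂F) + g K · m^A` is FALSE (`not_step_polyInSize`).  So the size-dependence of
any valid budget is super-polynomial EVEN AT A BOUNDED NUMBER OF TERMS (`K = 6A + 3` suffices against
degree `A`), no matter how fast the budget is allowed to grow with `K`; the crux's `2^((log₂ m+2)^A)`
is the first natural survivor.  This subsumes the refuted rev-1 step `DerivedPencilRolle` (budget
`(m+K)^a`, tree `not_DerivedPencilRolle`) and the `A = 1` slice of the crux (companion file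
`DerivedPencilRolleQuasiExponentTwo.lean`), and is the mirror image of the term-direction lemma
(companion `DerivedPencilRolleQuasiTermFactor.lean`: at size `2` the budget must grow at least linearly
in `K`).  The degree-`0` case says in particular that no budget depending on `K` ALONE works.

Proof.  Replace `g` by its monotone majorant `ĝ K = Σ_{k ≤ K} g k`; the tree's abstract-budget glue
(`posRoots_le_of_step`, `alternations_le_of_step`) turns the step into the alternation bound
`N ≤ K·C'^K·ĝ K·m^A` for every symmetric `K`-term pencil; the STAIRCASE family (`DPR.stub_stair`,
`DPR.exists_symm_pencil_alternating`) with `L = 6A+1` levels has `K = 6A+3` terms (a constant), size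
`≤ (256·2^(6L)+7)·n^6` and `n^L − 1` alternations: `Q·(F n^6)^A = D·n^(6A) < n^(6A+1) − 1` for
`n = 2(D+1)` (`stair_arith_polyInSize`, the tree's `stub_arith` with an arbitrary constant). [folklore]
-/

-- `Summit.ValiantsHypothesis.ValiantsHypothesis.…` repeats a component by the D-0017 layout.
set_option linter.dupNamespace false

namespace Summit.ValiantsHypothesis.ValiantsHypothesis.Theorems.DerivedPencilRolleQuasi.Negative

open scoped BigOperators Matrix Polynomial
open Polynomial
open Summit.ValiantsHypothesis.ValiantsHypothesis.Theorems.SymmetroidDescartes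
  (posRoots_le_of_step alternations_le_of_step)
open Summit.ValiantsHypothesis.ValiantsHypothesis.Theorems.SymmetroidDescartes.DPR
  (size_le stub_stair exists_symm_pencil_alternating)

/-! ## Arithmetic: the staircase beats `Q · m^a` for any constant `Q` -/

/-- For every constant `Q` and degree `a` there is an even `n ≥ 2` with
`Q · m(n)^a < n^(6a+1) − 1`, where `m(n) = 4·(((2^L−1)(n+1)+1)·(2^L·n·2))^3 + 7`, `L = 6a+1`, is the
symmetrised staircase size. [folklore] -/
theorem stair_arith_polyInSize (Q a : ℕ) : ∃ n : ℕ, 2 ≤ n ∧ Even n ∧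
    Q * (4 * (((2 ^ (6 * a + 1) - 1) * (n + 1) + 1) * (2 ^ (6 * a + 1) * n * 2)) ^ 3 + 7) ^ a
      < n ^ (6 * a + 1) - 1 := by
  set L := 6 * a + 1 with hL
  set E := 2 ^ L with hE
  set F := 256 * E ^ 6 + 7 with hF
  set D := Q * F ^ a with hD
  refine ⟨2 * (D + 1), by omega, even_two_mul _, ?_⟩
  set n := 2 * (D + 1) with hn
  have hn1 : 1 ≤ n := by omega
  have hsize : 4 * (((E - 1) * (n + 1) + 1) * (E * n * 2)) ^ 3 + 7 ≤ F * n ^ 6 := by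
    have h1 := size_le E n hn1
    have h2 : (((E - 1) * (n + 1) + 1) * (E * n * 2)) ^ 3 ≤ (4 * E ^ 2 * n ^ 2) ^ 3 :=
      Nat.pow_le_pow_left h1 3
    have h3 : 1 ≤ n ^ 6 := Nat.one_le_pow _ _ hn1
    calc 4 * (((E - 1) * (n + 1) + 1) * (E * n * 2)) ^ 3 + 7
        ≤ 4 * (4 * E ^ 2 * n ^ 2) ^ 3 + 7 * n ^ 6 := by nlinarith
      _ = F * n ^ 6 := by rw [hF]; ring
  have hbound : Q * (4 * (((E - 1) * (n + 1) + 1) * (E * n * 2)) ^ 3 + 7) ^ a ≤ D * n ^ (6 * a) := by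
    calc Q * (4 * (((E - 1) * (n + 1) + 1) * (E * n * 2)) ^ 3 + 7) ^ a
        ≤ Q * (F * n ^ 6) ^ a := Nat.mul_le_mul_left _ (Nat.pow_le_pow_left hsize a)
      _ = D * n ^ (6 * a) := by rw [hD, mul_pow, ← pow_mul]; ring
  have hpow : 1 ≤ n ^ (6 * a) := Nat.one_le_pow _ _ hn1
  have hmain : D * n ^ (6 * a) + 2 ≤ n ^ L := by
    have h1 : n ^ L = n ^ (6 * a) * n := by rw [hL, pow_succ]
    have h2 : n ^ (6 * a) * n = 2 * (D * n ^ (6 * a)) + 2 * n ^ (6 * a) := by rw [hn]; ring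
    rw [h1, h2]
    omega
  omega

/-! ## No budget polynomial in the size -/

/-- **For every `g : ℕ → ℕ`, `C` and `A`, the step `Z₊(det F) ≤ C·Z₊(det ∂F) + g K · m^A` is
false.**  Any valid budget is super-polynomial in the size `m` already at `K = 6A+3` terms, whatever
its growth in the number of terms (staircase with `6A+1` levels). [folklore] -/
theorem not_step_polyInSize (g : ℕ → ℕ) (C A : ℕ) :
    ¬ ∀ (m K : ℕ) (S : Fin (K + 1) → Matrix (Fin m) (Fin m) ℝ) (d : Fin (K + 1) → ℕ),
      (∀ l, (S l).IsSymm) → (∀ l, (S l).det ≠ 0) → StrictMono d →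
        ((∑ l, (Polynomial.X : Polynomial ℝ) ^ d l • (S l).map Polynomial.C).det.roots.toFinset.filter
            (fun t => 0 < t)).card ≤
          C * ((∑ l : Fin K, (Polynomial.X : Polynomial ℝ) ^ (d l.succ - d 0 - 1) •
            (((d l.succ - d 0 : ℕ) : ℝ) • S l.succ).map Polynomial.C).det.roots.toFinset.filter
              (fun t => 0 < t)).card + g K * m ^ A := by
  intro h
  -- monotone majorant of `g`
  set B : ℕ → ℕ → ℕ := fun m K => (∑ k ∈ Finset.range (K + 1), g k) * m ^ A with hB
  have hgB : ∀ m K, g K * m ^ A ≤ B m K := fun m K =>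
    Nat.mul_le_mul_right _ (Finset.single_le_sum (f := g) (fun _ _ => Nat.zero_le _)
      (Finset.mem_range.2 (Nat.lt_succ_self K)))
  have hBmono : ∀ m K K', K ≤ K' → B m K ≤ B m K' := fun m K K' hKK' =>
    Nat.mul_le_mul_right _ (Finset.sum_le_sum_of_subset (Finset.range_mono (Nat.succ_le_succ hKK')))
  have h' : ∀ (m K : ℕ) (S : Fin (K + 1) → Matrix (Fin m) (Fin m) ℝ) (d : Fin (K + 1) → ℕ),
      (∀ l, (S l).IsSymm) → (∀ l, (S l).det ≠ 0) → StrictMono d →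
        ((∑ l, (Polynomial.X : Polynomial ℝ) ^ d l • (S l).map Polynomial.C).det.roots.toFinset.filter
            (fun t => 0 < t)).card ≤
          C * ((∑ l : Fin K, (Polynomial.X : Polynomial ℝ) ^ (d l.succ - d 0 - 1) •
            (((d l.succ - d 0 : ℕ) : ℝ) • S l.succ).map Polynomial.C).det.roots.toFinset.filter
              (fun t => 0 < t)).card + B m K :=
    fun m K S d hS hdet hd => (h m K S d hS hdet hd).trans (Nat.add_le_add_left (hgB m K) _)
  have hiter := posRoots_le_of_step C B hBmono h'
  have hbound := alternations_le_of_step (max C 1) (le_max_right _ _) B hBmono hiter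
  -- the staircase with `L = 6A + 1` levels, `K = 6A + 3` terms
  set Q : ℕ := (6 * A + 1 + 1 + 1) * max C 1 ^ (6 * A + 1 + 1 + 1) *
    ∑ k ∈ Finset.range (6 * A + 1 + 1 + 1 + 1), g k with hQ
  obtain ⟨n, hn, he, harith⟩ := stair_arith_polyInSize Q A
  have hL1 : 1 ≤ 6 * A + 1 := by omega
  have hnL : 1 ≤ n ^ (6 * A + 1) := Nat.one_le_pow _ _ (by omega)
  obtain ⟨gph, d, v₀, lam, wstar, c, hlen, hlam, hc, hgap, hsign⟩ :=
    stub_stair n (6 * A + 1) (n ^ (6 * A + 1) - 1) hn he hL1 (Nat.sub_add_cancel hnL)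
  obtain ⟨S, e, hS, τ, hτ, hpos, halt⟩ :=
    exists_symm_pencil_alternating d gph v₀ lam wstar c hlam hc hgap hsign
  have hN := hbound (6 * A + 1 + 1 + 1) _ S e hS (n ^ (6 * A + 1) - 1) τ hτ hpos halt
  rw [hlen, Fintype.card_prod, Fintype.card_fin, Fintype.card_bool] at hN
  have hN' : n ^ (6 * A + 1) - 1 ≤
      Q * (4 * (((2 ^ (6 * A + 1) - 1) * (n + 1) + 1) * (2 ^ (6 * A + 1) * n * 2)) ^ 3 + 7) ^ A := by
    refine hN.trans (le_of_eq ?_)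
    rw [hQ]
    ring
  exact absurd harith (not_lt.2 hN')

/-- Degree `0`: **no budget depending on the number of terms alone works** — for every `g` and `C`,
`Z₊(det F) ≤ C·Z₊(det ∂F) + g K` fails (three-term symmetric pencils of growing size). [folklore] -/
theorem not_step_sizeFree (g : ℕ → ℕ) (C : ℕ) :
    ¬ ∀ (m K : ℕ) (S : Fin (K + 1) → Matrix (Fin m) (Fin m) ℝ) (d : Fin (K + 1) → ℕ),
      (∀ l, (S l).IsSymm) → (∀ l, (S l).det ≠ 0) → StrictMono d →
        ((∑ l, (Polynomial.X : Polynomial ℝ) ^ d l • (S l).map Polynomial.C).det.roots.toFinset.filter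
            (fun t => 0 < t)).card ≤
          C * ((∑ l : Fin K, (Polynomial.X : Polynomial ℝ) ^ (d l.succ - d 0 - 1) •
            (((d l.succ - d 0 : ℕ) : ℝ) • S l.succ).map Polynomial.C).det.roots.toFinset.filter
              (fun t => 0 < t)).card + g K := by
  intro h
  refine not_step_polyInSize g C 0 fun m K S d hS hdet hd => ?_
  simpa using h m K S d hS hdet hd

/-- Packaged: the natural strengthening / variant of the crux with a budget `(K+1)^(A·K) · m^A`
(term factor kept, quasi-polynomial size factor replaced by a polynomial one) is false. [folklore] -/
theorem not_derivedPencilRolleQuasi_polyInSize :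
    ¬ ∃ C A : ℕ, ∀ (m K : ℕ) (S : Fin (K + 1) → Matrix (Fin m) (Fin m) ℝ) (d : Fin (K + 1) → ℕ),
      (∀ l, (S l).IsSymm) → (∀ l, (S l).det ≠ 0) → StrictMono d →
        ((∑ l, (Polynomial.X : Polynomial ℝ) ^ d l • (S l).map Polynomial.C).det.roots.toFinset.filter
            (fun t => 0 < t)).card ≤
          C * ((∑ l : Fin K, (Polynomial.X : Polynomial ℝ) ^ (d l.succ - d 0 - 1) •
            (((d l.succ - d 0 : ℕ) : ℝ) • S l.succ).map Polynomial.C).det.roots.toFinset.filter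
              (fun t => 0 < t)).card + (K + 1) ^ (A * K) * m ^ A :=
  fun ⟨C, A, h⟩ => not_step_polyInSize (fun K => (K + 1) ^ (A * K)) C A h

end Summit.ValiantsHypothesis.ValiantsHypothesis.Theorems.DerivedPencilRolleQuasi.Negative
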